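import Summits.Parity.GeneralizedHardyLittlewood.Theorems.PrimeLevelFamEdgePeterssonBoundOfFormula
import Literature.NumberTheory.LFunctions.KowalskiMichelPeterssonFormulaOfHeckeL2
import Literature.NumberTheory.ModularForms.PoincareSeriesWeightTwoL2OfGram
import Literature.NumberTheory.ModularForms.PoincareSeriesWeightTwoGramLimit

/-!
# Route `PrimeLevelFamEdge`, crux item `PeterssonBoundPrinted` (stmt-Parity-20404) — HOLDS

The route's named fact `PeterssonBoundPrinted := KowalskiMichel2000.kowalskiMichel2000_peterssonBound`
(Kowalski–Michel 2000, (23) p. 312, gcd form) is PROVED: Petersson's formula at prime level and weight 2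
(`KowalskiMichel2000.kowalskiMichel2000_peterssonFormula`) is now a theorem of the Literature — the
weight-2 Poincaré series by Hecke's trick (Iwaniec–Kowalski §14.1–14.2, fact skeleton I1, line
`poincare_hecke` of cell `landau-siegel/ls-inputs`): the `L²` step is the Gram limit
`PoincareWeightTwo.tendsto_gram_peterssonPairing` fed into `PoincareWeightTwo.heckeL2_at_of_gram_limit`,
and `KowalskiMichel2000.peterssonFormula_of_heckeL2` composes all the other landed pieces; the theorem of
record is `KowalskiMichel2000.kowalskiMichel2000_peterssonFormula_holds`
(`Literature/NumberTheory/LFunctions/KowalskiMichelPeterssonFormulaHolds.lean`; the same term is inlined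
here so that this file does not wait for that module) — and (23) follows by the kernel reduction
`Theorems.peterssonBoundPrinted_of_peterssonFormula` (Weil's bound is the tree's theorem).
Standard axioms only.
«The programme SEARCHES and TYPES; no claim about Landau–Siegel zeros, Theorems 1–2 of
arXiv:2211.02515 or a repaired Margin232 until a kernel theorem says so.»
-/

namespace Summit.Parity.GeneralizedHardyLittlewood.Theses.PrimeLevelFamEdge

open Literature.NumberTheory.LFunctions
open Literature.NumberTheory.ModularForms.PoincareWeightTwo

/-- **Crux item `PeterssonBoundPrinted` (stmt-Parity-20404) HOLDS**: the Kowalski–Michel printed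
Petersson-type bound in gcd form, `kowalskiMichel2000_peterssonBound` — Petersson's formula (weight-2
Poincaré series, Hecke's trick, Gram/`L²` limit) then (23) by Weil's bound.
[cite: KowalskiMichel2000, §2.4.2 p. 312 (Petersson's formula and (23))] -/
theorem peterssonBoundPrinted_holds : PeterssonBoundPrinted :=
  Summit.Parity.GeneralizedHardyLittlewood.Theorems.peterssonBoundPrinted_of_peterssonFormula
    (KowalskiMichel2000.peterssonFormula_of_heckeL2 fun N _ _ hm ↦
      heckeL2_at_of_gram_limit N hm _ (tendsto_gram_peterssonPairing hm))

end Summit.Parity.GeneralizedHardyLittlewood.Theses.PrimeLevelFamEdge
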